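import Mathlib.NumberTheory.NumberField.Basic
import Mathlib.NumberTheory.NumberField.InfinitePlace.Basic
import Mathlib.NumberTheory.NumberField.Completion.FinitePlace
import Mathlib.NumberTheory.Padics.PadicNumbers
import Mathlib.Analysis.Normed.Field.WithAbs
import Mathlib.Analysis.SpecialFunctions.Exp
import Mathlib.Algebra.CharP.Defs
import Mathlib.Data.Nat.Prime.Basic
import HarnessLib

/-!
# [IUTchI] §0 Notations and Conventions — "Numbers" and "Curves"

Mochizuki, *Inter-universal Teichmüller theory I: construction of Hodge theaters*,
kurims manuscript (May 2020), §0 "Notations and Conventions", paragraphs **Numbers** and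
**Curves**, kurims pp. 35–36 [cite: Mochizuki2012, §0 pp.35-36] (D-0012 claim key, series
status DISPUTED; the conventions recorded here are classical algebraic number theory and take
no side).

Typed here:

* the abbreviations NF / MLF / CAF ("as defined in [AbsTopI], §0; [AbsTopIII], §0", p. 35) —
  `IsNF`, `IsMLF`, `IsCAF`;
* `Primes`, the set of prime numbers (p. 35) — `Primes`;
* for a number field `F`: the set of valuations `V(F) = V(F)^arc ∪ V(F)^non` (p. 35: "this
  terminology 'valuation' … corresponds to such terminology as 'place' or 'absolute value' in
  the work of other authors") — `Val`, `Val.IsArc`, `Val.IsNon`, `Val.arc`, `Val.non`;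
  the completion `F_v` — `Val.Completion`; "integral [at `v`]" = of norm `≤ 1` — `Val.IsIntegral`;
  `p_v` = the residue characteristic for `v` nonarchimedean, `p_v = e = 2.71828…` for `v`
  archimedean (pp. 35–36) — `residueChar`, `Val.pv`.

Design: `V(F)` is the disjoint union of Mathlib's `NumberField.InfinitePlace F` and
`NumberField.FinitePlace F` (both are real absolute values on `F`); `F_v` is Mathlib's
`AbsoluteValue.Completion`.  `p_v` is recorded as a REAL NUMBER (the form in which it enters
log-volume computations); for archimedean `v` the printed `p_v ∈ F_v` is the image of this real
number under `ℝ ⊆ F_v`.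

Deliberately NOT here: the notation `L_v` for a [possibly infinite] Galois extension `L/F`
("by a slight abuse of notation … the completion of `L` at some valuation lying over `v`") and the
extension of `V(F)`, `F_v`, `p_v` to infinite extensions of `ℚ` by limits (p. 36, prose
conventions); the paragraph **Curves** (p. 36) only imports terminology — hyperbolic curve, cusp,
stable log curve, smooth log curve ([SemiAnbd] §0) and hyperbolic orbicurve ([Cusp] §0) — which
belongs to the π₁ / curves interface of seats abc-iut-L3-*, abc-iut-L4-t1 (TODO-merge) and is
not re-typed here.  No printed statement is strengthened.
-/

namespace Literature.IUT.HodgeTheaters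

open NumberField

universe u

/-! ### NF, MLF, CAF; `Primes` (p. 35) -/

/-- NF: `F` is a *number field*, i.e. a finite extension of the field of rational numbers
(IUTchI §0 p. 35, "[AbsTopI], §0") — Mathlib's `NumberField`. [cite: Mochizuki2012, §0 p.35] -/
abbrev IsNF (F : Type u) [Field F] : Prop := NumberField F

/-- MLF: `K` is a *mixed-characteristic [nonarchimedean] local field*, i.e. a finite extension of
`ℚ_p` for some prime number `p` (IUTchI §0 p. 35, "[AbsTopI], §0; [AbsTopIII], §0").
TODO-merge:abc-iut-L4-t1 (the [AbsTopIII] §0 owner may refine this to a topological-field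
predicate). [cite: Mochizuki2012, §0 p.35] -/
def IsMLF (K : Type u) [Field K] : Prop :=
  ∃ (p : ℕ) (_ : Fact p.Prime) (f : ℚ_[p] →+* K), (f.toAlgebra : Algebra ℚ_[p] K).toModule.Finite

/-- CAF: `K` is a *complex archimedean field*, i.e. a topological field isomorphic to the field
of complex numbers (IUTchI §0 p. 35, "[AbsTopI], §0; [AbsTopIII], §0").
[cite: Mochizuki2012, §0 p.35] -/
def IsCAF (K : Type u) [Field K] [TopologicalSpace K] : Prop :=
  ∃ e : K ≃+* ℂ, Continuous e ∧ Continuous e.symm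

/-- `Primes`: the set of prime numbers (IUTchI §0 p. 35). [cite: Mochizuki2012, §0 p.35] -/
def Primes : Set ℕ := {p | p.Prime}

/-- Membership in `Primes` is primality. [cite: Mochizuki2012, §0 p.35] -/
theorem mem_Primes {p : ℕ} : p ∈ Primes ↔ p.Prime := Iff.rfl

/-! ### Valuations of a number field (pp. 35–36) -/

section Valuations

variable (F : Type u) [Field F] [NumberField F]

/-- `V(F) = V(F)^arc ∪ V(F)^non`: the set of *valuations* of the number field `F`, i.e. the union
of the sets of archimedean and nonarchimedean valuations [= places] of `F` (IUTchI §0 p. 35),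
realised as the disjoint union of Mathlib's infinite and finite places.
[cite: Mochizuki2012, §0 p.35] -/
def Val : Type u := InfinitePlace F ⊕ FinitePlace F

variable {F}

namespace Val

/-- `V(F)^arc ⊆ V(F)`: the archimedean valuations. [cite: Mochizuki2012, §0 p.35] -/
def IsArc (v : Val F) : Prop := v.isLeft

/-- `V(F)^non ⊆ V(F)`: the nonarchimedean valuations. [cite: Mochizuki2012, §0 p.35] -/
def IsNon (v : Val F) : Prop := v.isRight

/-- The archimedean valuation determined by an infinite place. [cite: Mochizuki2012, §0 p.35] -/
def arc (w : InfinitePlace F) : Val F := Sum.inl w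

/-- The nonarchimedean valuation determined by a finite place. [cite: Mochizuki2012, §0 p.35] -/
def non (w : FinitePlace F) : Val F := Sum.inr w

/-- Every valuation is archimedean or nonarchimedean, and not both: `V(F)` is the DISJOINT union
`V(F)^arc ∪ V(F)^non`. [cite: Mochizuki2012, §0 p.35] -/
theorem isArc_or_isNon (v : Val F) : (v.IsArc ∧ ¬ v.IsNon) ∨ (v.IsNon ∧ ¬ v.IsArc) := by
  rcases v with w | w
  · exact Or.inl ⟨rfl, by simp [IsNon]⟩
  · exact Or.inr ⟨rfl, by simp [IsArc]⟩

/-- The real absolute value on `F` underlying a valuation `v ∈ V(F)` ("place" / "absolute value"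
in the work of other authors, p. 35). [cite: Mochizuki2012, §0 p.35] -/
def absoluteValue : Val F → AbsoluteValue F ℝ
  | Sum.inl w => w.val
  | Sum.inr w => w.val

/-- `F_v`: the completion of `F` at `v` (IUTchI §0 p. 35) — Mathlib's completion of `F` with
respect to the absolute value of `v`. [cite: Mochizuki2012, §0 p.35] -/
abbrev Completion (v : Val F) : Type u := (absoluteValue v).Completion

/-- An element of `F` is *integral [at `v`]* if it is of norm `≤ 1` with respect to the
valuation `v` (IUTchI §0 p. 35). [cite: Mochizuki2012, §0 p.35] -/
def IsIntegral (v : Val F) (x : F) : Prop := absoluteValue v x ≤ 1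

/-- An element of `F_v` is *integral* if it is of norm `≤ 1` (IUTchI §0 p. 35).
[cite: Mochizuki2012, §0 p.35] -/
def IsIntegralCompletion (v : Val F) (x : Completion v) : Prop := ‖x‖ ≤ 1

end Val

/-- The residue characteristic of a finite place: the characteristic of the residue field of the
corresponding maximal ideal of `𝓞_F` (IUTchI §0 p. 36: "If `v ∈ V(F)^non`, then we shall write
`p_v` for the residue characteristic of `v`"). [cite: Mochizuki2012, §0 p.36] -/
noncomputable def residueChar (w : FinitePlace F) : ℕ :=
  ringChar (𝓞 F ⧸ w.maximalIdeal.asIdeal)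

namespace Val

/-- `p_v` as a real number: the residue characteristic of `v` if `v ∈ V(F)^non`; if
`v ∈ V(F)^arc`, "the unique positive real element of `F_v` whose natural logarithm is equal to
`1` [i.e., `e = 2.71828…`]" (IUTchI §0 p. 36). [cite: Mochizuki2012, §0 p.36] -/
noncomputable def pv : Val F → ℝ
  | Sum.inl _ => Real.exp 1
  | Sum.inr w => residueChar w

/-- For archimedean `v`, `log p_v = 1`. [cite: Mochizuki2012, §0 p.36] -/
theorem log_pv_arc (w : InfinitePlace F) : Real.log (pv (arc w)) = 1 := by
  simp [pv, arc]

/-- For archimedean `v`, `p_v` is positive. [cite: Mochizuki2012, §0 p.36] -/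
theorem pv_arc_pos (w : InfinitePlace F) : 0 < pv (arc w) := Real.exp_pos 1

/-- For nonarchimedean `v`, `p_v` is the residue characteristic. [cite: Mochizuki2012, §0 p.36] -/
theorem pv_non (w : FinitePlace F) : pv (non w) = residueChar w := rfl

end Val

end Valuations

end Literature.IUT.HodgeTheaters
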